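import Summits.BirchSwinnertonDyer.BirchSwinnertonDyer.Theorems.CyclotomicUntwistInertiaOverCyclotomicNine
import HarnessLib

/-!
# A Dirichlet character mod `9` with prescribed value at the generator `2` of `(ℤ/9)ˣ`
# (print layer (T) of crux child C1, file 3a: the untwisting character)

Cell `pub/bsd-wall` (D-0145 line `route-BirchSwinnertonDyer-CyclotomicUntwist`), seat `bsd-line-cycu-p1`
(K1/K2 LEAD lineage, gen 8). THEOREMS ONLY (no definition, no named fact, no `sorry`); helper toward the crux
child C1 = stmt-BirchSwinnertonDyer-27548 through the print layer (T) (files 1–2: p646654, p647742). BSD is not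
proved by this file; no crux and no child of the route is proved by it.

WHAT. `(ℤ/9)ˣ` is cyclic of order `6` generated by `2` (`2, 4, 8, 7, 5, 1`). For every sixth root of unity
`c ∈ ℂ` there is a Dirichlet character `ε` mod `9` with `ε(2) = c` (`exists_dirichletCharacter_nine_apply_two_eq`),
built as `u ↦ c^{log₂ u}` on the units; `ε(4) = c²`, `ε(1) = 1`; and if `c² ≠ 1` then `ε` is PRIMITIVE (conductor
`9`: it does not factor through `(ℤ/3)ˣ`, whose kernel in `(ℤ/9)ˣ` is `{1, 4, 7} ∋ 4`;
`isPrimitive_of_apply_four_ne_one`). In the (T) layer `c = ι(ζ₀)⁻¹` for an eigenvalue `ζ₀` of the inertia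
generator `τ` (`χ₉(τ) = 2`) on `V_ℓ(W) ⊗ ℚ̄_ℓ`, `ζ₀⁶ = 1`, `ζ₀² ≠ 1` on the wild principal-series rows — so that
`ε = η̄` is the character by which the route UNTWISTS (`g₀ = (f_W ⊗ η̄)^{new}`).

References: [cite: Washington1997, Ch. 3 (pp. 19–21: Dirichlet characters mod p^k, conductor)] ·
[cite: DiamondShurman2005, §4.3].
-/

set_option autoImplicit false
-- single-conjunct summit: `Summit.BirchSwinnertonDyer.BirchSwinnertonDyer.…` repeats the name by design
set_option linter.dupNamespace false

noncomputable section

namespace Summit.BirchSwinnertonDyer.BirchSwinnertonDyer.Theorems.NineCharacter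

open Summit.BirchSwinnertonDyer.BirchSwinnertonDyer.Theorems.InertiaOverCyclotomicNine (exists_coe_eq_two_pow)

/-- The discrete logarithm to base `2` on `(ℤ/9)ˣ` is additive mod `6` (checked on the `36` pairs).
[folklore] -/
theorem dlog_mul (u v : (ZMod 9)ˣ) (a b c : Fin 6) (ha : (u : ZMod 9) = 2 ^ (a : ℕ))
    (hb : (v : ZMod 9) = 2 ^ (b : ℕ)) (hc : ((u * v : (ZMod 9)ˣ) : ZMod 9) = 2 ^ (c : ℕ)) :
    (c : ℕ) % 6 = ((a : ℕ) + b) % 6 := by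
  have key : ∀ a b c : Fin 6, (2 : ZMod 9) ^ (a : ℕ) * 2 ^ (b : ℕ) = 2 ^ (c : ℕ) →
      (c : ℕ) % 6 = ((a : ℕ) + b) % 6 := by decide
  apply key a b c
  rw [← ha, ← hb, ← hc, Units.val_mul]

/-- **A Dirichlet character mod `9` with `ε(2) = c` for any sixth root of unity `c ∈ ℂ`**, with `ε(4) = c²`.
[cite: Washington1997, Ch. 3] -/
theorem exists_dirichletCharacter_nine_apply_two_eq (c : ℂ) (hc : c ^ 6 = 1) :
    ∃ ε : DirichletCharacter ℂ 9, ε (2 : ZMod 9) = c ∧ ε (4 : ZMod 9) = c ^ 2 := by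
  classical
  have hc0 : c ≠ 0 := by
    intro h; rw [h, zero_pow (by norm_num)] at hc; exact zero_ne_one hc
  -- the discrete logarithm
  let dlog : (ZMod 9)ˣ → ℕ := fun u => ((exists_coe_eq_two_pow u).choose : ℕ)
  have hdlog : ∀ u : (ZMod 9)ˣ, (u : ZMod 9) = 2 ^ dlog u := fun u => (exists_coe_eq_two_pow u).choose_spec
  have hdlog_lt : ∀ u : (ZMod 9)ˣ, dlog u < 6 := fun u => (exists_coe_eq_two_pow u).choose.isLt
  -- `c ^ n` only depends on `n mod 6`
  have hcpow : ∀ n : ℕ, c ^ n = c ^ (n % 6) := fun n => by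
    conv_lhs => rw [← Nat.mod_add_div n 6, pow_add, pow_mul, hc, one_pow, mul_one]
  let cu : ℂˣ := Units.mk0 c hc0
  let f : (ZMod 9)ˣ →* ℂˣ :=
    { toFun := fun u => cu ^ dlog u
      map_one' := by
        have h1 : dlog 1 % 6 = 0 := by
          have := hdlog 1
          have key : ∀ j : Fin 6, ((1 : (ZMod 9)ˣ) : ZMod 9) = 2 ^ (j : ℕ) → (j : ℕ) % 6 = 0 := by decide
          exact key ⟨dlog 1, hdlog_lt 1⟩ this
        ext
        rw [Units.val_pow_eq_pow_val, Units.val_mk0, hcpow, h1, pow_zero, Units.val_one]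
      map_mul' := fun u v => by
        ext
        rw [Units.val_mul, Units.val_pow_eq_pow_val, Units.val_pow_eq_pow_val, Units.val_pow_eq_pow_val,
          Units.val_mk0, ← pow_add, hcpow (dlog (u * v)), hcpow (dlog u + dlog v),
          dlog_mul u v ⟨dlog u, hdlog_lt u⟩ ⟨dlog v, hdlog_lt v⟩ ⟨dlog (u * v), hdlog_lt (u * v)⟩
            (hdlog u) (hdlog v) (hdlog (u * v))] }
  have hf : ∀ u : (ZMod 9)ˣ, (MulChar.ofUnitHom f) (u : ZMod 9) = c ^ dlog u := fun u => by
    rw [MulChar.ofUnitHom_coe]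
    change ((cu ^ dlog u : ℂˣ) : ℂ) = c ^ dlog u
    rw [Units.val_pow_eq_pow_val, Units.val_mk0]
  -- the units `2` and `4`
  let u2 : (ZMod 9)ˣ := ZMod.unitOfCoprime 2 (by decide)
  let u4 : (ZMod 9)ˣ := ZMod.unitOfCoprime 4 (by decide)
  have h2 : dlog u2 % 6 = 1 := by
    have key : ∀ j : Fin 6, ((u2 : (ZMod 9)ˣ) : ZMod 9) = 2 ^ (j : ℕ) → (j : ℕ) % 6 = 1 := by decide
    exact key ⟨dlog u2, hdlog_lt u2⟩ (hdlog u2)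
  have h4 : dlog u4 % 6 = 2 := by
    have key : ∀ j : Fin 6, ((u4 : (ZMod 9)ˣ) : ZMod 9) = 2 ^ (j : ℕ) → (j : ℕ) % 6 = 2 := by decide
    exact key ⟨dlog u4, hdlog_lt u4⟩ (hdlog u4)
  refine ⟨MulChar.ofUnitHom f, ?_, ?_⟩
  · have := hf u2
    rw [ZMod.coe_unitOfCoprime, Nat.cast_ofNat] at this
    rw [this, hcpow, h2, pow_one]
  · have := hf u4
    rw [ZMod.coe_unitOfCoprime, Nat.cast_ofNat] at this
    rw [this, hcpow, h4]

/-- **Primitivity:** a Dirichlet character `ε` mod `9` with `ε(4) ≠ 1` has conductor `9` (the kernel of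
`(ℤ/9)ˣ → (ℤ/3)ˣ` is `{1, 4, 7}`, so `ε` does not factor through level `3`, nor `1`).
[cite: Washington1997, Ch. 3 (conductor of a Dirichlet character)] -/
theorem isPrimitive_of_apply_four_ne_one (ε : DirichletCharacter ℂ 9) (h4 : ε (4 : ZMod 9) ≠ 1) :
    ε.IsPrimitive := by
  classical
  rw [DirichletCharacter.isPrimitive_def]
  have hdvd : ε.conductor ∣ 9 := ε.conductor_dvd_level
  -- `ε` does not factor through `3`
  have h3 : ¬ ε.conductor ∣ 3 := by
    intro h
    have hmem : 3 ∈ ε.conductorSet :=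
      (DirichletCharacter.mem_conductorSet_iff_conductor_dvd ε (by norm_num : 3 ∣ 9)).mpr h
    have hft : ε.FactorsThrough 3 := hmem
    rw [DirichletCharacter.factorsThrough_iff_ker_unitsMap (by norm_num : 3 ∣ 9)] at hft
    let u4 : (ZMod 9)ˣ := ZMod.unitOfCoprime 4 (by decide)
    have hker : u4 ∈ (ZMod.unitsMap (by norm_num : 3 ∣ 9)).ker := by
      rw [MonoidHom.mem_ker]; decide
    have h1 := hft hker
    rw [MonoidHom.mem_ker] at h1
    apply h4
    have h1' := congrArg (fun x : ℂˣ => (x : ℂ)) h1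
    simp only [MulChar.coe_toUnitHom, Units.val_one] at h1'
    rw [ZMod.coe_unitOfCoprime, Nat.cast_ofNat] at h1'
    exact h1'
  -- divisors of `9 = 3²` not dividing `3`: only `9`
  obtain ⟨k, hk, hk'⟩ := (Nat.dvd_prime_pow Nat.prime_three).mp (by simpa using hdvd : ε.conductor ∣ 3 ^ 2)
  interval_cases k
  · exfalso; apply h3; rw [hk']; norm_num
  · exfalso; apply h3; rw [hk']; norm_num
  · rw [hk']; norm_num

end Summit.BirchSwinnertonDyer.BirchSwinnertonDyer.Theorems.NineCharacter

end
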